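import Mathlib
import HarnessLib
import Summits.Langlands.Langlands.Theses.MirrorPairReflection

/-!
# Birth skeleton (BC3) for crux stmt-Langlands-12834
`Summit.Langlands.Langlands.Theses.MirrorPairReflection.NonSelfMirrorReducible` — line `birth`

Route `route-Langlands-MirrorPairReflection` (rank-2 crux; the open residue of the even,
residually-reducible, conductor-`p^∞` sector of (B) for `GL₂/ℚ`). The crux: `p` odd,
`σ : Γ_ℚ → GL₂(ℚ̄_p)` continuous (`FramedGaloisRep ℚ (PadicAlgCl p) 2`), unramified outside `p`,
residual type `(a,b)` by the trace congruence `‖tr σ(g) − χ_p(g)^a − χ_p(g)^b‖ < 1`, `a+b` even,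
`m := (b−a) mod (p−1)` a NON-self-mirror index (`¬ (p−1) ∣ 2(b−a)`), `p ∣ B_m` and `p ∣ B_{p−1−m}`
(a genuine mirror pair) ⟹ `σ` is REDUCIBLE.

The skeleton is the classical trichotomy of the projective image of an irreducible `σ`
(potentially scalar = finite projective image / imprimitive = induced from an index-2 subgroup /
neither = infinite primitive projective image, "Lie-open"), which is exactly how the route's own
crux text and KILL CRITERION (ii) cut the claim ("no ARTIN σ has this type — a finite subgroup of
`GL₂(ℤ̄_p)` reducing into a Borel is `P ⋊ C`, an irreducible plane forces the dihedral shape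
`m = (p−1)/2`; … an irreducible even σ with INFINITE PROJECTIVE IMAGE at a genuine mirror pair refutes
NonSelfMirrorReducible"):

* `stub_potentiallyScalar_induced` — **finite projective image ⟹ imprimitive.** `p` odd, `σ`
  irreducible of residual type `(a,b)` and scalar on a finite-index subgroup ⟹ `σ` is diagonal on a
  subgroup of index `2` (in some frame). Group theory of `G = σ(Γ_ℚ)`: the residual
  semisimplification is `ω^a ⊕ ω^b` (traces, `n = 2 < p`), so `G` has a normal pro-`p` subgroup `P`
  (preimage of the unipotent radical of the residual Borel) with `G/P` abelian of order prime to `p`;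
  `P` is scalar-by-(finite `p`-group), `p` odd, so `σ|_P = ψ₁ ⊕ ψ₂`; `ψ₁ = ψ₂` would make `[G,G] ⊆ P`
  scalar with `λ² = det = 1`, `λ = 1` in a pro-`p` group, `G` abelian, `σ` reducible; so `ψ₁ ≠ ψ₂` and
  irreducibility makes `G` swap the two isotypic lines: their stabiliser has index `2`. KNOWN-TYPE (L).
* `stub_induced_selfMirror` — **imprimitive ⟹ self-mirror index.** `σ` irreducible, unramified outside
  `p`, residual type `(a,b)`, diagonal on an index-2 subgroup `H` ⟹ `(p−1) ∣ 2(b−a)`. For: `H` is closed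
  (else `σ` is diagonal on `H̄ = Γ_ℚ`), its quadratic field `K` is unramified at every `ℓ ≠ p` (an
  inertia element outside `H` has `σ = 1`, trace `2`, but `Γ_ℚ ∖ H` acts antidiagonally: trace `0`), so
  `K = ℚ(√p*)` and `ε_K = ω^{(p−1)/2}`; trace `0` off `H` gives `ω^a(g) + ω^b(g) = 0` whenever
  `ω(g)^{(p−1)/2} = −1`, i.e. `a − b ≡ (p−1)/2 (mod p−1)`. KNOWN-TYPE (L; Kronecker–Weber for the
  quadratic field of conductor `p`).
* `stub_infiniteProjectiveImage_rigidity` — **THE OPEN CORE (rigidity in the Lie-open case).** Under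
  ALL the crux hypotheses (even, genuine non-self mirror pair, conductor `p^∞`), an irreducible `σ`
  that is neither potentially scalar nor induced does not exist. Equivalently: no even
  `σ : G_{ℚ,{p,∞}} → GL₂(ℚ̄_p)` of residual type `(a,b)` whose image has Lie algebra containing `sl₂`.
  Intended interior (route header, TWO-LAYER PLAN): both Ribet endpoint lattices are non-split
  (they exist: `p ∣ B_m`, `p ∣ B_{p−1−m}`), and the even deformation ring of the non-split residual
  extension, of expected relative dimension `h¹(ad⁰) − h²(ad⁰) = 0`, presented by McCallum–Sharifi cup
  products, should have only reducible `ℚ̄_p`-points (`R^even = R^red`, Böckle 1999 template, which is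
  proved when `P_{S}` is a Poincaré group of rank 2 and FAILS to apply verbatim at a mirror pair).
  OPEN (XL); its `why it might fail` is the crux's (an isolated even open-image point, cf.
  Ramakrishna's even surjective examples with auxiliary ramification).
* `NonSelfMirrorReducible_of` — the composition, kernel-checked, no `sorry`: assume `σ` irreducible;
  if induced, stub 2 contradicts `¬ (p−1) ∣ 2(b−a)`; else if potentially scalar, stub 1 makes it
  induced; else stub 3. Concludes the route decl BY NAME.

Honest reading of the cut: stubs 1–2 are genuine theorems (each needs lattice/reduction or
class-field input absent from the tree: M–L each), and they remove exactly the two image types for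
which the claim is KNOWN; stub 3 is the crux on the remaining (Lie-open) locus with two extra
structural hypotheses in hand — located, not dissolved. Every stub is implied by the crux only
together with the others (stub 3 alone does not give the crux: the Artin/dihedral cases are missing;
stubs 1–2 conclude imprimitivity / a congruence, not reducibility).

Disproof used: none on file for this crux (`ledger crux ls stmt-Langlands-12834`: no workfiles, no
`Disproof.lean`, no `Negative/` lemmas; `ledger negatives --problem Langlands`: 3 entries, none in
this sector) — 2026-08-17.

Shape (for `ledger skeleton check`): stubs `theorem stub_<name> : <signature> := by sorry` stated over
tree declarations only (the route file's own constants: `FramedGaloisRep`, `FramedRep.trace`,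
`FramedRep.IsIrreducible`, `FramedGaloisRep.IsUnramifiedAt`, `GaloisRep.cyclotomicCharacter`,
`PadicAlgCl`, `bernoulli`, Mathlib `Subgroup.index`); `_Goal.stub_<name> : Prop := type_of% @stub_<name>`
names each statement; the vocabulary of §0 is definitional sugar with `Iff.rfl` lemmas and is NOT used
in the stub signatures.
-/

set_option linter.dupNamespace false
set_option linter.unusedVariables false

noncomputable section

namespace Summit.Langlands.Langlands.Cruxes.NonSelfMirrorReducible.Birth

open Summit.Langlands.Langlands.Theses.MirrorPairReflection
open Literature.NumberTheory.GaloisRepresentations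

/-! ## 0. Vocabulary (definitional sugar; not used in the stub signatures) -/

section Vocabulary

variable {p : ℕ} [Fact p.Prime]

/-- **Residual type `(a,b)` by traces**: `‖tr σ(g) − χ_p(g)^a − χ_p(g)^b‖ < 1` for all `g ∈ Γ_ℚ`
(`χ_p` the `p`-adic cyclotomic character; for `n = 2 < p` this pins `σ̄^ss = ω^a ⊕ ω^b`). Verbatim the
crux's hypothesis. [folklore] -/
def HasResidualType (σ : FramedGaloisRep ℚ (PadicAlgCl p) 2) (a b : ℕ) : Prop :=
  ∀ g : Field.absoluteGaloisGroup ℚ,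
    ‖FramedRep.trace σ g -
        ((algebraMap ℚ_[p] (PadicAlgCl p)
              (((GaloisRep.cyclotomicCharacter ℚ p g : ℤ_[p]ˣ) : ℤ_[p]) : ℚ_[p])) ^ a +
          (algebraMap ℚ_[p] (PadicAlgCl p)
              (((GaloisRep.cyclotomicCharacter ℚ p g : ℤ_[p]ˣ) : ℤ_[p]) : ℚ_[p])) ^ b)‖ < 1

/-- **Unramified outside `p`** (conductor `p^∞`): verbatim the crux's hypothesis. [folklore] -/
def IsUnramifiedOutside (σ : FramedGaloisRep ℚ (PadicAlgCl p) 2) : Prop :=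
  ∀ v : IsDedekindDomain.HeightOneSpectrum (NumberField.RingOfIntegers ℚ),
    ((p : ℕ) : NumberField.RingOfIntegers ℚ) ∉ v.asIdeal → σ.IsUnramifiedAt v

/-- **Imprimitive (induced from an index-two subgroup)**: in some frame `P`, `σ` is DIAGONAL on a
subgroup `H ≤ Γ_ℚ` of index `2`. For irreducible `σ` this is `σ ≅ Ind_H^{Γ_ℚ} ψ` (and `H` is then
automatically closed, i.e. `H = Γ_K` for a quadratic field `K`). Same typing of "dihedral" as the
route's `SelfMirrorDihedral` (there with `H = Γ_{ℚ(√p)}`). [cite: SerreLinearRepresentations1977, §7.2–7.3] -/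
def IsInducedIndexTwo (σ : FramedGaloisRep ℚ (PadicAlgCl p) 2) : Prop :=
  ∃ (P : Matrix.GeneralLinearGroup (Fin 2) (PadicAlgCl p)) (H : Subgroup (Field.absoluteGaloisGroup ℚ)),
    H.index = 2 ∧ ∀ g ∈ H,
      ((P * σ g * P⁻¹ : Matrix.GeneralLinearGroup (Fin 2) (PadicAlgCl p)) :
          Matrix (Fin 2) (Fin 2) (PadicAlgCl p)) 0 1 = 0 ∧
      ((P * σ g * P⁻¹ : Matrix.GeneralLinearGroup (Fin 2) (PadicAlgCl p)) :
          Matrix (Fin 2) (Fin 2) (PadicAlgCl p)) 1 0 = 0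

/-- **Potentially scalar (finite projective image)**: `σ` is SCALAR on some subgroup `N ≤ Γ_ℚ` of
finite index (`0 < N.index`; Mathlib's `Subgroup.index` is `0` for infinite index). Equivalently the
image of `σ` in `PGL₂(ℚ̄_p)` is finite; over `ℚ` (Tate: `H²(Γ_ℚ, ℚ/ℤ) = 0`) equivalently `σ` is a twist
of an Artin representation by a character. [cite: Serre1968, §2] -/
def IsPotentiallyScalar (σ : FramedGaloisRep ℚ (PadicAlgCl p) 2) : Prop :=
  ∃ N : Subgroup (Field.absoluteGaloisGroup ℚ), 0 < N.index ∧ ∀ g ∈ N,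
    ((σ g : Matrix.GeneralLinearGroup (Fin 2) (PadicAlgCl p)) : Matrix (Fin 2) (Fin 2) (PadicAlgCl p)) 0 1 = 0 ∧
    ((σ g : Matrix.GeneralLinearGroup (Fin 2) (PadicAlgCl p)) : Matrix (Fin 2) (Fin 2) (PadicAlgCl p)) 1 0 = 0 ∧
    ((σ g : Matrix.GeneralLinearGroup (Fin 2) (PadicAlgCl p)) : Matrix (Fin 2) (Fin 2) (PadicAlgCl p)) 0 0 =
      ((σ g : Matrix.GeneralLinearGroup (Fin 2) (PadicAlgCl p)) : Matrix (Fin 2) (Fin 2) (PadicAlgCl p)) 1 1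

end Vocabulary

/-! ## 1. The three stubs -/

/-- **STUB 1 — finite projective image ⟹ imprimitive (the Artin / potentially-abelian case).**
`p` odd; `σ : Γ_ℚ → GL₂(ℚ̄_p)` continuous of residual type `(a,b)` (trace congruence), irreducible,
and SCALAR on a finite-index subgroup `N`. THEN `σ` is diagonal on an index-2 subgroup in some frame
(induced from a quadratic field). Proof sketch: `G = σ(Γ_ℚ)` is compact, stabilises a lattice over the
(open) valuation ring of `ℚ̄_p` (tree: `exists_integralModel_of_valuationSubring`); Brauer–Nesbitt in
rank 2 (`p ≠ 2`: `det = (tr² − tr∘sq)/2`) gives `σ̄^ss = ω^a ⊕ ω^b`, so `Ḡ` lies in a Borel; `P :=`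
preimage in `G` of its unipotent radical is a normal PRO-`p` subgroup with `G/P` abelian (inside the
residual torus). `P/(P ∩ scalars)` is a finite `p`-group (finite projective image), so `V|_P` is
semisimple (average over the finite quotient); if `V|_P` were irreducible, a central element `z ≠ 1` of
`P/(P ∩ scalars)` lifts to `p₀` with `[p₀, x] = λI`, `λ² = 1`, `λI` of `p`-power order ⟹ `λ = 1`, so
`σ(p₀)` is a `P`-endomorphism hence scalar (Schur), contradiction; so `σ|_P = ψ₁ ⊕ ψ₂`. If `ψ₁ = ψ₂`
then `σ(P)` is scalar, `[G,G] ⊆ σ(P)` consists of scalars `λ` with `λ² = 1` of `p`-power order, so `G`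
is abelian and `σ` reducible — excluded; hence `ψ₁ ≠ ψ₂`, `G` permutes the two isotypic lines, and
irreducibility forces a swap: the stabiliser `H` has index `2` and `σ|_H` is diagonal in the eigenbasis.
Needs no ramification or parity hypothesis; `p ≠ 2` is essential (quaternion images). Size: L
(lattice + reduction + the finite-group argument; none of it is in the tree for `ℚ̄_p`-coefficients).
[cite: SerreLinearRepresentations1977, §8.1 Prop. 24 and §8.2] [cite: Serre1968, §2] -/
theorem stub_potentiallyScalar_induced :
    ∀ (p : ℕ) [Fact p.Prime], p ≠ 2 →
      ∀ (σ : Literature.NumberTheory.GaloisRepresentations.FramedGaloisRep ℚ (PadicAlgCl p) 2) (a b : ℕ),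
        (∀ g : Field.absoluteGaloisGroup ℚ,
            ‖Literature.NumberTheory.GaloisRepresentations.FramedRep.trace σ g -
                ((algebraMap ℚ_[p] (PadicAlgCl p)
                      (((Literature.NumberTheory.GaloisRepresentations.GaloisRep.cyclotomicCharacter ℚ p g :
                          ℤ_[p]ˣ) : ℤ_[p]) : ℚ_[p])) ^ a +
                  (algebraMap ℚ_[p] (PadicAlgCl p)
                      (((Literature.NumberTheory.GaloisRepresentations.GaloisRep.cyclotomicCharacter ℚ p g :
                          ℤ_[p]ˣ) : ℤ_[p]) : ℚ_[p])) ^ b)‖ < 1) →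
        Literature.NumberTheory.GaloisRepresentations.FramedRep.IsIrreducible σ →
        (∃ N : Subgroup (Field.absoluteGaloisGroup ℚ), 0 < N.index ∧ ∀ g ∈ N,
            ((σ g : Matrix.GeneralLinearGroup (Fin 2) (PadicAlgCl p)) :
                Matrix (Fin 2) (Fin 2) (PadicAlgCl p)) 0 1 = 0 ∧
            ((σ g : Matrix.GeneralLinearGroup (Fin 2) (PadicAlgCl p)) :
                Matrix (Fin 2) (Fin 2) (PadicAlgCl p)) 1 0 = 0 ∧
            ((σ g : Matrix.GeneralLinearGroup (Fin 2) (PadicAlgCl p)) :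
                Matrix (Fin 2) (Fin 2) (PadicAlgCl p)) 0 0 =
              ((σ g : Matrix.GeneralLinearGroup (Fin 2) (PadicAlgCl p)) :
                Matrix (Fin 2) (Fin 2) (PadicAlgCl p)) 1 1) →
        ∃ (P : Matrix.GeneralLinearGroup (Fin 2) (PadicAlgCl p))
          (H : Subgroup (Field.absoluteGaloisGroup ℚ)),
          H.index = 2 ∧ ∀ g ∈ H,
            ((P * σ g * P⁻¹ : Matrix.GeneralLinearGroup (Fin 2) (PadicAlgCl p)) :
                Matrix (Fin 2) (Fin 2) (PadicAlgCl p)) 0 1 = 0 ∧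
            ((P * σ g * P⁻¹ : Matrix.GeneralLinearGroup (Fin 2) (PadicAlgCl p)) :
                Matrix (Fin 2) (Fin 2) (PadicAlgCl p)) 1 0 = 0 := by
  sorry

/-- **STUB 2 — imprimitive ⟹ self-mirror index (the dihedral case is `m = (p−1)/2`).**
`p` odd; `σ : Γ_ℚ → GL₂(ℚ̄_p)` continuous, unramified outside `p`, of residual type `(a,b)`,
irreducible, and diagonal on an index-2 subgroup `H` in some frame `P`. THEN `(p−1) ∣ 2(b−a)`, i.e.
`b − a ≡ 0` or `(p−1)/2 (mod p−1)`. Proof sketch: the locus where `PσP⁻¹` is diagonal is a closed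
subgroup containing `H`; it is not `Γ_ℚ` (irreducibility), so `H` is closed of index 2, `H = Γ_K`,
`K/ℚ` quadratic. On `H`, `PσP⁻¹ = diag(ψ₁, ψ₂)` with `ψ₁ ≠ ψ₂` (else the image is abelian), so every
`g ∉ H` acts ANTIDIAGONALLY: `tr σ(g) = 0` off `H`. If a prime `ℓ ≠ p` ramified in `K`, an inertia
element `g ∉ H` at `ℓ` would have `σ(g) = 1` (unramified: inertia acts trivially), trace `2 ≠ 0`;
so `K` is unramified outside `p`: `K = ℚ(√p*)`, `p* = (−1)^{(p−1)/2} p`, the quadratic subfield of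
`ℚ(ζ_p)`, with character `ε_K = ω^{(p−1)/2}` (Kronecker–Weber; tree `KroneckerWeber_holds`). Take `g`
with `χ_p(g) mod p = ζ` a generator of `𝔽_p^×` (the mod-`p` cyclotomic character is onto): `g ∉ H`,
so `‖χ_p(g)^a + χ_p(g)^b‖ < 1`, i.e. `ζ^a + ζ^b = 0` in `𝔽_p`, `ζ^{a−b} = −1 = ζ^{(p−1)/2}`,
`a − b ≡ (p−1)/2 (mod p−1)`, whence `(p−1) ∣ 2(b−a)`. Parity and Bernoulli hypotheses are not
needed. Size: L (closure/normaliser computation in `GL₂`, inertia groups vs. the quadratic field,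
conductor-`p` quadratic fields).
[cite: Washington1997, Thm. 14.1 (Kronecker–Weber) and Thm. 3.11 (conductor–discriminant)]
[cite: SerreLinearRepresentations1977, §7.2 Prop. 20] -/
theorem stub_induced_selfMirror :
    ∀ (p : ℕ) [Fact p.Prime], p ≠ 2 →
      ∀ (σ : Literature.NumberTheory.GaloisRepresentations.FramedGaloisRep ℚ (PadicAlgCl p) 2) (a b : ℕ),
        (∀ v : IsDedekindDomain.HeightOneSpectrum (NumberField.RingOfIntegers ℚ),
            ((p : ℕ) : NumberField.RingOfIntegers ℚ) ∉ v.asIdeal → σ.IsUnramifiedAt v) →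
        (∀ g : Field.absoluteGaloisGroup ℚ,
            ‖Literature.NumberTheory.GaloisRepresentations.FramedRep.trace σ g -
                ((algebraMap ℚ_[p] (PadicAlgCl p)
                      (((Literature.NumberTheory.GaloisRepresentations.GaloisRep.cyclotomicCharacter ℚ p g :
                          ℤ_[p]ˣ) : ℤ_[p]) : ℚ_[p])) ^ a +
                  (algebraMap ℚ_[p] (PadicAlgCl p)
                      (((Literature.NumberTheory.GaloisRepresentations.GaloisRep.cyclotomicCharacter ℚ p g :
                          ℤ_[p]ˣ) : ℤ_[p]) : ℚ_[p])) ^ b)‖ < 1) →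
        Literature.NumberTheory.GaloisRepresentations.FramedRep.IsIrreducible σ →
        (∃ (P : Matrix.GeneralLinearGroup (Fin 2) (PadicAlgCl p))
            (H : Subgroup (Field.absoluteGaloisGroup ℚ)),
            H.index = 2 ∧ ∀ g ∈ H,
              ((P * σ g * P⁻¹ : Matrix.GeneralLinearGroup (Fin 2) (PadicAlgCl p)) :
                  Matrix (Fin 2) (Fin 2) (PadicAlgCl p)) 0 1 = 0 ∧
              ((P * σ g * P⁻¹ : Matrix.GeneralLinearGroup (Fin 2) (PadicAlgCl p)) :
                  Matrix (Fin 2) (Fin 2) (PadicAlgCl p)) 1 0 = 0) →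
        ((p : ℤ) - 1 ∣ 2 * ((b : ℤ) - a)) := by
  sorry

/-- **STUB 3 — THE OPEN CORE: rigidity at a genuine mirror pair in the Lie-open case.**
`p` odd; `σ : Γ_ℚ → GL₂(ℚ̄_p)` continuous, unramified outside `p`, residual type `(a,b)`, `a+b`
even, `¬ (p−1) ∣ 2(b−a)` (non-self-mirror index `m = (b−a) mod (p−1)`), `p ∣ B_m`, `p ∣ B_{p−1−m}`
(genuine mirror pair), and `σ` is NEITHER potentially scalar (finite projective image) NOR induced
from an index-2 subgroup. THEN `σ` is reducible. (For an irreducible `σ` the two extra hypotheses say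
its image has infinite, primitive projective image, i.e. the `E`-span of the Lie algebra of the image
contains `sl₂` — the "isolated even open-image point" of the crux's `why it might fail`.) This is the
crux restricted to the locus where nothing is known; every hypothesis is load-bearing: drop `Even`
and `ρ_{Δ,691}` (residually `1 ⊕ ω^{11}`, open image, conductor `691^∞`) is a counterexample in kind;
drop the mirror divisibilities and the statement is MirrorCriterion's (support item, provable now).
Intended interior (route header, TWO-LAYER PLAN / CHEAPEST FALSIFIER; to be cut by crux-plan, not
here): (i) both Ribet endpoint lattices of `σ` reduce to the NON-SPLIT extensions `(ω^a * ; 0 ω^b)`,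
`(ω^b * ; 0 ω^a)` (Ribet 1976 Prop. 2.1; they exist exactly because `p ∣ B_{p−1−m}`, `p ∣ B_m`);
(ii) `R^even = R^red` for the non-split even residual extension unramified outside `p`: expected
relative dimension `h¹(ad⁰) − h²(ad⁰) = 0` (complex conjugation is trivial on `ad`), presentation by
McCallum–Sharifi cup products of cyclotomic `p`-units; Böckle 1999 proves `R^even ≅ W(k)[[T]]` with
ALL deformations reducible when `P_S` is a Poincaré group of rank 2 — which fails at a mirror pair
(`d(P_S) ≥ 3`), so this is a bet, not a port. No instance exists below `8192` (no mirror pair), so the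
statement is numerically untestable today. Size: XL / open problem.
[cite: Bockle1999, Thm. 2.12 and Prop. 3.7] [cite: Ribet1976, Prop. 2.1] [cite: MccallumSharifi2003, Thm. 1.1]
[cite: Ramakrishna1998, Thm. 1] [cite: Calegari2011, Thm. 1.1] -/
theorem stub_infiniteProjectiveImage_rigidity :
    ∀ (p : ℕ) [Fact p.Prime], p ≠ 2 →
      ∀ (σ : Literature.NumberTheory.GaloisRepresentations.FramedGaloisRep ℚ (PadicAlgCl p) 2) (a b : ℕ),
        (∀ v : IsDedekindDomain.HeightOneSpectrum (NumberField.RingOfIntegers ℚ),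
            ((p : ℕ) : NumberField.RingOfIntegers ℚ) ∉ v.asIdeal → σ.IsUnramifiedAt v) →
        Even (a + b) → ¬ ((p : ℤ) - 1 ∣ 2 * ((b : ℤ) - a)) →
        (∀ g : Field.absoluteGaloisGroup ℚ,
            ‖Literature.NumberTheory.GaloisRepresentations.FramedRep.trace σ g -
                ((algebraMap ℚ_[p] (PadicAlgCl p)
                      (((Literature.NumberTheory.GaloisRepresentations.GaloisRep.cyclotomicCharacter ℚ p g :
                          ℤ_[p]ˣ) : ℤ_[p]) : ℚ_[p])) ^ a +
                  (algebraMap ℚ_[p] (PadicAlgCl p)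
                      (((Literature.NumberTheory.GaloisRepresentations.GaloisRep.cyclotomicCharacter ℚ p g :
                          ℤ_[p]ˣ) : ℤ_[p]) : ℚ_[p])) ^ b)‖ < 1) →
        ((p : ℤ) ∣ (bernoulli ((((b : ℤ) - a) % ((p : ℤ) - 1)).toNat)).num) →
        ((p : ℤ) ∣ (bernoulli (p - 1 - (((b : ℤ) - a) % ((p : ℤ) - 1)).toNat)).num) →
        ¬ (∃ N : Subgroup (Field.absoluteGaloisGroup ℚ), 0 < N.index ∧ ∀ g ∈ N,
            ((σ g : Matrix.GeneralLinearGroup (Fin 2) (PadicAlgCl p)) :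
                Matrix (Fin 2) (Fin 2) (PadicAlgCl p)) 0 1 = 0 ∧
            ((σ g : Matrix.GeneralLinearGroup (Fin 2) (PadicAlgCl p)) :
                Matrix (Fin 2) (Fin 2) (PadicAlgCl p)) 1 0 = 0 ∧
            ((σ g : Matrix.GeneralLinearGroup (Fin 2) (PadicAlgCl p)) :
                Matrix (Fin 2) (Fin 2) (PadicAlgCl p)) 0 0 =
              ((σ g : Matrix.GeneralLinearGroup (Fin 2) (PadicAlgCl p)) :
                Matrix (Fin 2) (Fin 2) (PadicAlgCl p)) 1 1) →
        ¬ (∃ (P : Matrix.GeneralLinearGroup (Fin 2) (PadicAlgCl p))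
            (H : Subgroup (Field.absoluteGaloisGroup ℚ)),
            H.index = 2 ∧ ∀ g ∈ H,
              ((P * σ g * P⁻¹ : Matrix.GeneralLinearGroup (Fin 2) (PadicAlgCl p)) :
                  Matrix (Fin 2) (Fin 2) (PadicAlgCl p)) 0 1 = 0 ∧
              ((P * σ g * P⁻¹ : Matrix.GeneralLinearGroup (Fin 2) (PadicAlgCl p)) :
                  Matrix (Fin 2) (Fin 2) (PadicAlgCl p)) 1 0 = 0) →
        ¬ Literature.NumberTheory.GaloisRepresentations.FramedRep.IsIrreducible σ := by
  sorry

/-! ## 2. The stub statements as named `Prop`s (literally their types) -/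

namespace _Goal

/-- The statement of `stub_potentiallyScalar_induced`, as a named `Prop` (literally its type). [folklore] -/
def stub_potentiallyScalar_induced : Prop :=
  type_of% @Summit.Langlands.Langlands.Cruxes.NonSelfMirrorReducible.Birth.stub_potentiallyScalar_induced

/-- The statement of `stub_induced_selfMirror`, as a named `Prop` (literally its type). [folklore] -/
def stub_induced_selfMirror : Prop :=
  type_of% @Summit.Langlands.Langlands.Cruxes.NonSelfMirrorReducible.Birth.stub_induced_selfMirror

/-- The statement of `stub_infiniteProjectiveImage_rigidity`, as a named `Prop` (literally its type). [folklore] -/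
def stub_infiniteProjectiveImage_rigidity : Prop :=
  type_of% @Summit.Langlands.Langlands.Cruxes.NonSelfMirrorReducible.Birth.stub_infiniteProjectiveImage_rigidity

end _Goal

/-- The three named statements over this file's vocabulary (definitional). [folklore] -/
theorem goals_iff :
    (_Goal.stub_potentiallyScalar_induced ↔
      ∀ (p : ℕ) [Fact p.Prime], p ≠ 2 → ∀ (σ : FramedGaloisRep ℚ (PadicAlgCl p) 2) (a b : ℕ),
        HasResidualType σ a b → FramedRep.IsIrreducible σ → IsPotentiallyScalar σ →
          IsInducedIndexTwo σ) ∧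
    (_Goal.stub_induced_selfMirror ↔
      ∀ (p : ℕ) [Fact p.Prime], p ≠ 2 → ∀ (σ : FramedGaloisRep ℚ (PadicAlgCl p) 2) (a b : ℕ),
        IsUnramifiedOutside σ → HasResidualType σ a b → FramedRep.IsIrreducible σ →
          IsInducedIndexTwo σ → ((p : ℤ) - 1 ∣ 2 * ((b : ℤ) - a))) ∧
    (_Goal.stub_infiniteProjectiveImage_rigidity ↔
      ∀ (p : ℕ) [Fact p.Prime], p ≠ 2 → ∀ (σ : FramedGaloisRep ℚ (PadicAlgCl p) 2) (a b : ℕ),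
        IsUnramifiedOutside σ → Even (a + b) → ¬ ((p : ℤ) - 1 ∣ 2 * ((b : ℤ) - a)) →
          HasResidualType σ a b →
          ((p : ℤ) ∣ (bernoulli ((((b : ℤ) - a) % ((p : ℤ) - 1)).toNat)).num) →
          ((p : ℤ) ∣ (bernoulli (p - 1 - (((b : ℤ) - a) % ((p : ℤ) - 1)).toNat)).num) →
          ¬ IsPotentiallyScalar σ → ¬ IsInducedIndexTwo σ → ¬ FramedRep.IsIrreducible σ) :=
  ⟨Iff.rfl, Iff.rfl, Iff.rfl⟩

/-- The crux unfolded over the vocabulary (definitional). [folklore] -/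
theorem nonSelfMirrorReducible_iff :
    NonSelfMirrorReducible ↔
      ∀ (p : ℕ) [Fact p.Prime], p ≠ 2 → ∀ (σ : FramedGaloisRep ℚ (PadicAlgCl p) 2) (a b : ℕ),
        IsUnramifiedOutside σ → Even (a + b) → ¬ ((p : ℤ) - 1 ∣ 2 * ((b : ℤ) - a)) →
          HasResidualType σ a b →
          ((p : ℤ) ∣ (bernoulli ((((b : ℤ) - a) % ((p : ℤ) - 1)).toNat)).num) →
          ((p : ℤ) ∣ (bernoulli (p - 1 - (((b : ℤ) - a) % ((p : ℤ) - 1)).toNat)).num) →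
          ¬ FramedRep.IsIrreducible σ :=
  Iff.rfl

/-! ## 3. The composition (kernel-checked, no `sorry`): the projective-image trichotomy -/

/-- **`NonSelfMirrorReducible` from the three stubs.** Given the crux's data and an irreducible `σ`:
if `σ` is induced from an index-2 subgroup, `stub_induced_selfMirror` gives `(p−1) ∣ 2(b−a)`,
contradicting the non-self-mirror hypothesis; otherwise, if `σ` is potentially scalar,
`stub_potentiallyScalar_induced` makes it induced — contradiction; otherwise
`stub_infiniteProjectiveImage_rigidity` says `σ` is reducible. The hypotheses are, by name, the
statements of the three stubs; the conclusion is the route decl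
`Summit.Langlands.Langlands.Theses.MirrorPairReflection.NonSelfMirrorReducible`. [folklore] -/
theorem NonSelfMirrorReducible_of (hA : _Goal.stub_potentiallyScalar_induced)
    (hB : _Goal.stub_induced_selfMirror) (hC : _Goal.stub_infiniteProjectiveImage_rigidity) :
    Summit.Langlands.Langlands.Theses.MirrorPairReflection.NonSelfMirrorReducible := by
  -- the stub statements, as the Π-types they literally are
  have hA' : type_of% @stub_potentiallyScalar_induced := hA
  have hB' : type_of% @stub_induced_selfMirror := hB
  have hC' : type_of% @stub_infiniteProjectiveImage_rigidity := hC
  intro p _ hp σ a b hU hE hm hT d1 d2 hI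
  by_cases hind : IsInducedIndexTwo σ
  · -- imprimitive: the quadratic field is `ℚ(√p*)` and the index is self-mirror
    exact hm (hB' p hp σ a b hU hT hI hind)
  · by_cases hsc : IsPotentiallyScalar σ
    · -- finite projective image: imprimitive after all
      exact hind (hA' p hp σ a b hT hI hsc)
    · -- infinite primitive projective image: the open core
      exact hC' p hp σ a b hU hE hm hT d1 d2 hsc hind hI

/-- By-name sanity check (an `example`, not a declaration of the file): the three stubs feed the
composition as they stand. -/
example : Summit.Langlands.Langlands.Theses.MirrorPairReflection.NonSelfMirrorReducible :=
  NonSelfMirrorReducible_of stub_potentiallyScalar_induced stub_induced_selfMirror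
    stub_infiniteProjectiveImage_rigidity

end Summit.Langlands.Langlands.Cruxes.NonSelfMirrorReducible.Birth

end
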